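import Summits.Ventures.HodgeRepro2.T5SU11JacobiWeightDeriv
import Summits.Ventures.HodgeRepro2.T5SU11PhaseLawLintegral
import Summits.Ventures.HodgeRepro2.T5SU11JacobiLaplacePhase

/-!
# All derivatives of the Jacobi transform in the weight: `(−1)^n m̂^{(n)}_k(λ) = ∫_G (log|a|)^n m_k φ_λ dν`

`T5SU11JacobiWeightDeriv` / `T5SU11JacobiWeightDeriv2` differentiate the Laplace form
`m̂_k(λ) = ∫_G e^{−k s(g)} φ_λ(g) dν` once and twice under the integral sign. This file does it to EVERY
order: with the `n`-th moment integrands `M_n(k, g) := (−log|a(g)|)^n m_k(g) φ_λ(g)`,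

* every moment of the phase is finite on the ray `k > max(1, λ, 2 − λ)`
  (`integrable_momentIntegrand`, `integrable_log_pow_mul_orbit_rpow_mul_sph`: the dominating function
  `(n!/εⁿ) m_{k−2ε} φ_λ` from the elementary `sⁿ e^{−εs} ≤ n!/εⁿ`, `pow_mul_exp_neg_le`);
* `(d/dk) ∫_G M_n dν = ∫_G M_{n+1} dν` (`hasDerivAt_moment`, dominated differentiation under the integral);
* hence **`m̂^{(n)}_k(λ) = ∫_G (−log|a(g)|)^n m_k(g) φ_λ(g) dν`** for every `n`
  (`iteratedDeriv_jacobi_weight`), i.e. **`(−1)^n m̂^{(n)}_k(λ) = ∫_G (log|a|)^n m_k φ_λ dν ≥ 0`**, `> 0`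
  (`iteratedDeriv_jacobi_weight_eq_moment`, `iteratedDeriv_jacobi_weight_sign`,
  `iteratedDeriv_jacobi_weight_sign_pos`) — COMPLETE MONOTONICITY of the transform in the weight in its
  classical derivative form (the finite-difference form is `T5SU11JacobiCompleteMonotone`);
* in the phase variable, `(−1)^n m̂^{(n)}_k(λ) = 2π ∫_0^∞ sⁿ e^{−(k−2)s} Φ_λ(s) ds`
  (`integral_log_pow_mul_orbit_rpow_mul_sph_eq_phase`) — the moments of the positive measure
  `2π e^{2s} Φ_λ(s) ds` whose Laplace transform `m̂` is;
* at `λ = 0` (`Φ_0 ≡ 1`) the moments are `2π n!/(k − 2)^{n+1}` (`T5SU11PhaseLawLintegral`), so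
  `m̂^{(n)}_k(0) = (−1)^n 2π n!/(k − 2)^{n+1}`, the `n`-th derivative of `2π/(k − 2)`
  (`iteratedDeriv_jacobi_weight_zero`) — a cross-check of the whole chain.

Nothing is claimed about (N).

Blind lane: Mathlib + the HodgeRepro2 prefix only; no sorry; axioms ⊆ {propext, Classical.choice,
Quot.sound}.
-/

namespace Summit.Ventures.HodgeRepro2.T5SU11JacobiWeightDerivAll

open MeasureTheory MeasureTheory.Measure Metric Set Filter Topology
open T5SU11Unimodular T5SU11Fibration T5SU11Cartan T5SU11OneParameter T5SU11CartanProjection T5HaarCircle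
  T5BergmanCoefficient T5SU11FibrationHaar T5SU11SphericalFunction T5SU11SphericalSymmetry
  T5SU11SphericalBounds T5SU11SphericalContinuous T5SU11JacobiIwasawa T5SU11JacobiTransform
  T5SU11JacobiWeight T5SU11KFiniteMajorantPow T5SU11JacobiWeightDeriv T5SU11PhaseLaw
  T5SU11PhaseLawLintegral T5SU11JacobiLaplacePhase
open scoped Real

/-! ### The elementary bound `sⁿ e^{−εs} ≤ n!/εⁿ` -/

/-- **`sⁿ e^{−εs} ≤ n!/εⁿ`** for `s ≥ 0`, `ε > 0` (from `(εs)ⁿ/n! ≤ e^{εs}`). -/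
theorem pow_mul_exp_neg_le {s ε : ℝ} (hs : 0 ≤ s) (hε : 0 < ε) (n : ℕ) :
    s ^ n * Real.exp (-(ε * s)) ≤ (n.factorial : ℝ) / ε ^ n := by
  have h := Real.pow_div_factorial_le_exp (ε * s) (mul_nonneg hε.le hs) n
  have hf : (0 : ℝ) < n.factorial := by positivity
  have hεn : 0 < ε ^ n := pow_pos hε n
  rw [div_le_iff₀ hf, mul_pow] at h
  rw [Real.exp_neg, ← div_eq_mul_inv, div_le_div_iff₀ (Real.exp_pos _) hεn]
  calc s ^ n * ε ^ n = ε ^ n * s ^ n := mul_comm _ _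
    _ ≤ Real.exp (ε * s) * n.factorial := h
    _ = (n.factorial : ℝ) * Real.exp (ε * s) := mul_comm _ _

/-- `log|a(g)| > 0` off the rotation subgroup (`|a(g)| > 1` when `g·0 ≠ 0`). -/
theorem log_norm_mat_pos {g : SU11} (hg : orbit g ≠ 0) : 0 < Real.log ‖mat g 0 0‖ := by
  refine Real.log_pos ?_
  have h1 : 1 - ‖orbit g‖ ^ 2 < 1 := by
    have := norm_pos_iff.mpr hg
    nlinarith
  rw [one_sub_norm_orbit_sq] at h1
  have ha : 0 < ‖mat g 0 0‖ := norm_mat_pos g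
  by_contra h
  have h' : ‖mat g 0 0‖ ≤ 1 := not_lt.mp h
  have : 1 ≤ ‖mat g 0 0‖⁻¹ := (one_le_inv₀ ha).mpr h'
  nlinarith

section measure

variable [MeasurableSpace Circle] [BorelSpace Circle]

/-! ### The moment integrands and their derivatives in the weight -/

omit [BorelSpace Circle] in
/-- `(d/dk) M_n(k, g) = M_{n+1}(k, g)` for the moment integrands
`M_n(k, g) = (−log|a(g)|)^n m_k(g) φ_λ(g)`. -/
theorem hasDerivAt_momentIntegrand (lam : ℝ) (g : SU11) (n : ℕ) (k : ℝ) :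
    HasDerivAt (fun k : ℝ => (-(Real.log ‖mat g 0 0‖)) ^ n * ((1 - ‖orbit g‖ ^ 2) ^ (k / 2) * sph lam g))
      ((-(Real.log ‖mat g 0 0‖)) ^ (n + 1) * ((1 - ‖orbit g‖ ^ 2) ^ (k / 2) * sph lam g)) k := by
  have h := (hasDerivAt_orbit_rpow_mul_sph lam g k).const_mul ((-(Real.log ‖mat g 0 0‖)) ^ n)
  refine h.congr_deriv ?_
  ring

/-- The domination: for `x ≥ k − ε`, `‖M_n(x, g)‖ ≤ (n!/εⁿ) m_{k−2ε}(g) φ_λ(g)`. -/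
theorem momentIntegrand_bound {lam k ε x : ℝ} (hε : 0 < ε) (hxk : k - ε ≤ x) (n : ℕ) (g : SU11) :
    ‖(-(Real.log ‖mat g 0 0‖)) ^ n * ((1 - ‖orbit g‖ ^ 2) ^ (x / 2) * sph lam g)‖
      ≤ (n.factorial : ℝ) / ε ^ n * ((1 - ‖orbit g‖ ^ 2) ^ ((k - 2 * ε) / 2) * sph lam g) := by
  have hs0 : 0 ≤ Real.log ‖mat g 0 0‖ := log_norm_mat_nonneg g
  have hφ : 0 < sph lam g := sph_pos lam g
  rw [norm_mul, norm_pow, norm_neg, Real.norm_of_nonneg hs0,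
    Real.norm_of_nonneg (mul_nonneg (orbit_rpow_nonneg x g) hφ.le)]
  have hm : (1 - ‖orbit g‖ ^ 2) ^ (x / 2) ≤ (1 - ‖orbit g‖ ^ 2) ^ ((k - ε) / 2) :=
    orbit_rpow_antitone hxk g
  have hsplit : (1 - ‖orbit g‖ ^ 2) ^ ((k - ε) / 2)
      = Real.exp (-(ε * Real.log ‖mat g 0 0‖)) * (1 - ‖orbit g‖ ^ 2) ^ ((k - 2 * ε) / 2) := by
    rw [orbit_rpow_eq_exp, orbit_rpow_eq_exp, ← Real.exp_add]
    congr 1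
    ring
  calc Real.log ‖mat g 0 0‖ ^ n * ((1 - ‖orbit g‖ ^ 2) ^ (x / 2) * sph lam g)
      ≤ Real.log ‖mat g 0 0‖ ^ n * ((1 - ‖orbit g‖ ^ 2) ^ ((k - ε) / 2) * sph lam g) := by gcongr
    _ = (Real.log ‖mat g 0 0‖ ^ n * Real.exp (-(ε * Real.log ‖mat g 0 0‖)))
          * ((1 - ‖orbit g‖ ^ 2) ^ ((k - 2 * ε) / 2) * sph lam g) := by
        rw [hsplit]
        ring
    _ ≤ (n.factorial : ℝ) / ε ^ n * ((1 - ‖orbit g‖ ^ 2) ^ ((k - 2 * ε) / 2) * sph lam g) :=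
        mul_le_mul_of_nonneg_right (pow_mul_exp_neg_le hs0 hε n)
          (mul_nonneg (orbit_rpow_nonneg _ g) hφ.le)

/-- **Every moment of the phase is finite on the ray**: `M_n(k, ·)` is `ν`-integrable. -/
theorem integrable_momentIntegrand {k lam : ℝ} (hk : 1 < k) (h1 : lam < k) (h2 : 2 < k + lam) (n : ℕ) :
    Integrable (fun g => (-(Real.log ‖mat g 0 0‖)) ^ n * ((1 - ‖orbit g‖ ^ 2) ^ (k / 2) * sph lam g))
      (nu haarCircle) := by
  set K₀ : ℝ := max 1 (max lam (2 - lam)) with hK₀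
  have hK : K₀ < k := by
    rw [hK₀, max_lt_iff, max_lt_iff]
    exact ⟨hk, h1, by linarith⟩
  have hK1 : 1 ≤ K₀ := le_max_left _ _
  have hK2 : lam ≤ K₀ := (le_max_left _ _).trans (le_max_right _ _)
  have hK3 : 2 - lam ≤ K₀ := (le_max_right _ _).trans (le_max_right _ _)
  set ε : ℝ := (k - K₀) / 4 with hε
  have hε0 : 0 < ε := by
    rw [hε]
    linarith
  have hk' : 1 < k - 2 * ε := by rw [hε]; linarith
  have h1' : lam < k - 2 * ε := by rw [hε]; linarith
  have h2' : 2 < k - 2 * ε + lam := by rw [hε]; linarith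
  have hbound := (integrable_orbit_rpow_mul_sph hk' h1' h2').const_mul ((n.factorial : ℝ) / ε ^ n)
  refine Integrable.mono' hbound ?_ (Filter.Eventually.of_forall fun g => ?_)
  · exact ((continuous_log_norm_mat.neg.pow n).mul
      ((continuous_orbit_rpow k).mul (continuous_sph lam))).aestronglyMeasurable
  · exact momentIntegrand_bound hε0 (by linarith) n g

/-- The same with the sign removed: `(log|a|)^n m_k φ_λ` is `ν`-integrable on the ray. -/
theorem integrable_log_pow_mul_orbit_rpow_mul_sph {k lam : ℝ} (hk : 1 < k) (h1 : lam < k)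
    (h2 : 2 < k + lam) (n : ℕ) :
    Integrable (fun g => Real.log ‖mat g 0 0‖ ^ n * ((1 - ‖orbit g‖ ^ 2) ^ (k / 2) * sph lam g))
      (nu haarCircle) := by
  have h := (integrable_momentIntegrand hk h1 h2 n).const_mul ((-1 : ℝ) ^ n)
  refine h.congr (Filter.Eventually.of_forall fun g => ?_)
  show (-1 : ℝ) ^ n * ((-(Real.log ‖mat g 0 0‖)) ^ n * ((1 - ‖orbit g‖ ^ 2) ^ (k / 2) * sph lam g))
    = Real.log ‖mat g 0 0‖ ^ n * ((1 - ‖orbit g‖ ^ 2) ^ (k / 2) * sph lam g)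
  have hsq : ((-1 : ℝ) ^ n) * (-1) ^ n = 1 := by
    rw [← mul_pow]
    norm_num
  rw [neg_pow (Real.log ‖mat g 0 0‖)]
  linear_combination (Real.log ‖mat g 0 0‖ ^ n * ((1 - ‖orbit g‖ ^ 2) ^ (k / 2) * sph lam g)) * hsq

/-- **Differentiation under the integral at every order**: on the ray,
`(d/dk) ∫_G M_n(k, g) dν = ∫_G M_{n+1}(k, g) dν`. -/
theorem hasDerivAt_moment {k lam : ℝ} (hk : 1 < k) (h1 : lam < k) (h2 : 2 < k + lam) (n : ℕ) :
    HasDerivAt (fun k => ∫ g, (-(Real.log ‖mat g 0 0‖)) ^ n * ((1 - ‖orbit g‖ ^ 2) ^ (k / 2) * sph lam g)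
        ∂(nu haarCircle))
      (∫ g, (-(Real.log ‖mat g 0 0‖)) ^ (n + 1) * ((1 - ‖orbit g‖ ^ 2) ^ (k / 2) * sph lam g)
        ∂(nu haarCircle)) k := by
  set K₀ : ℝ := max 1 (max lam (2 - lam)) with hK₀
  have hK : K₀ < k := by
    rw [hK₀, max_lt_iff, max_lt_iff]
    exact ⟨hk, h1, by linarith⟩
  have hK1 : 1 ≤ K₀ := le_max_left _ _
  have hK2 : lam ≤ K₀ := (le_max_left _ _).trans (le_max_right _ _)
  have hK3 : 2 - lam ≤ K₀ := (le_max_right _ _).trans (le_max_right _ _)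
  set ε : ℝ := (k - K₀) / 4 with hε
  have hε0 : 0 < ε := by
    rw [hε]
    linarith
  have hk' : 1 < k - 2 * ε := by rw [hε]; linarith
  have h1' : lam < k - 2 * ε := by rw [hε]; linarith
  have h2' : 2 < k - 2 * ε + lam := by rw [hε]; linarith
  have hbound := (integrable_orbit_rpow_mul_sph hk' h1' h2').const_mul
    (((n + 1).factorial : ℝ) / ε ^ (n + 1))
  refine (hasDerivAt_integral_of_dominated_loc_of_deriv_le (ball_mem_nhds k hε0)
    (Filter.Eventually.of_forall fun x => ?_) (integrable_momentIntegrand hk h1 h2 n)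
    (F' := fun k g => (-(Real.log ‖mat g 0 0‖)) ^ (n + 1) * ((1 - ‖orbit g‖ ^ 2) ^ (k / 2) * sph lam g)) ?_
    (Filter.Eventually.of_forall fun g x hx => ?_) hbound
    (Filter.Eventually.of_forall fun g x _ => hasDerivAt_momentIntegrand lam g n x)).2
  · exact ((continuous_log_norm_mat.neg.pow n).mul
      ((continuous_orbit_rpow x).mul (continuous_sph lam))).aestronglyMeasurable
  · exact ((continuous_log_norm_mat.neg.pow (n + 1)).mul
      ((continuous_orbit_rpow k).mul (continuous_sph lam))).aestronglyMeasurable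
  · have hxk : k - ε ≤ x := by
      rw [mem_ball, Real.dist_eq, abs_lt] at hx
      linarith [hx.1]
    exact momentIntegrand_bound hε0 hxk (n + 1) g

/-! ### The iterated derivatives of the transform -/

/-- **ALL DERIVATIVES OF THE JACOBI TRANSFORM IN THE WEIGHT**: on the ray,
`m̂^{(n)}_k(λ) = ∫_G (−log|a(g)|)^n m_k(g) φ_λ(g) dν` for every `n`. -/
theorem iteratedDeriv_jacobi_weight (lam : ℝ) (n : ℕ) {k : ℝ} (hk : 1 < k) (h1 : lam < k)
    (h2 : 2 < k + lam) :
    iteratedDeriv n (fun k => ∫ g, (1 - ‖orbit g‖ ^ 2) ^ (k / 2) * sph lam g ∂(nu haarCircle)) k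
      = ∫ g, (-(Real.log ‖mat g 0 0‖)) ^ n * ((1 - ‖orbit g‖ ^ 2) ^ (k / 2) * sph lam g)
          ∂(nu haarCircle) := by
  induction n generalizing k with
  | zero => simp only [iteratedDeriv_zero, pow_zero, one_mul]
  | succ n ih =>
    rw [iteratedDeriv_succ]
    have hev : iteratedDeriv n (fun k => ∫ g, (1 - ‖orbit g‖ ^ 2) ^ (k / 2) * sph lam g ∂(nu haarCircle))
        =ᶠ[𝓝 k] fun k => ∫ g, (-(Real.log ‖mat g 0 0‖)) ^ n
          * ((1 - ‖orbit g‖ ^ 2) ^ (k / 2) * sph lam g) ∂(nu haarCircle) := by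
      have hmem : k ∈ Ioi (max 1 (max lam (2 - lam))) := by
        rw [Set.mem_Ioi, max_lt_iff, max_lt_iff]
        exact ⟨hk, h1, by linarith⟩
      filter_upwards [isOpen_Ioi.mem_nhds hmem] with x hx
      rw [Set.mem_Ioi, max_lt_iff, max_lt_iff] at hx
      exact ih hx.1 hx.2.1 (by linarith [hx.2.2])
    rw [hev.deriv_eq]
    exact (hasDerivAt_moment hk h1 h2 n).deriv

/-- **COMPLETE MONOTONICITY, DERIVATIVE FORM**: `(−1)^n m̂^{(n)}_k(λ) = ∫_G (log|a|)^n m_k φ_λ dν`. -/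
theorem iteratedDeriv_jacobi_weight_eq_moment (lam : ℝ) (n : ℕ) {k : ℝ} (hk : 1 < k) (h1 : lam < k)
    (h2 : 2 < k + lam) :
    (-1 : ℝ) ^ n
        * iteratedDeriv n (fun k => ∫ g, (1 - ‖orbit g‖ ^ 2) ^ (k / 2) * sph lam g ∂(nu haarCircle)) k
      = ∫ g, Real.log ‖mat g 0 0‖ ^ n * ((1 - ‖orbit g‖ ^ 2) ^ (k / 2) * sph lam g) ∂(nu haarCircle) := by
  rw [iteratedDeriv_jacobi_weight lam n hk h1 h2, ← integral_const_mul]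
  refine integral_congr_ae (Filter.Eventually.of_forall fun g => ?_)
  show (-1 : ℝ) ^ n * ((-(Real.log ‖mat g 0 0‖)) ^ n * ((1 - ‖orbit g‖ ^ 2) ^ (k / 2) * sph lam g))
    = Real.log ‖mat g 0 0‖ ^ n * ((1 - ‖orbit g‖ ^ 2) ^ (k / 2) * sph lam g)
  have hsq : ((-1 : ℝ) ^ n) * (-1) ^ n = 1 := by
    rw [← mul_pow]
    norm_num
  rw [neg_pow (Real.log ‖mat g 0 0‖)]
  linear_combination (Real.log ‖mat g 0 0‖ ^ n * ((1 - ‖orbit g‖ ^ 2) ^ (k / 2) * sph lam g)) * hsq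

/-- `(−1)^n m̂^{(n)}_k(λ) ≥ 0` on the ray, for every `n`. -/
theorem iteratedDeriv_jacobi_weight_sign (lam : ℝ) (n : ℕ) {k : ℝ} (hk : 1 < k) (h1 : lam < k)
    (h2 : 2 < k + lam) :
    0 ≤ (-1 : ℝ) ^ n
        * iteratedDeriv n (fun k => ∫ g, (1 - ‖orbit g‖ ^ 2) ^ (k / 2) * sph lam g ∂(nu haarCircle)) k := by
  rw [iteratedDeriv_jacobi_weight_eq_moment lam n hk h1 h2]
  exact integral_nonneg fun g => mul_nonneg (pow_nonneg (log_norm_mat_nonneg g) n)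
    (mul_nonneg (orbit_rpow_nonneg k g) (sph_pos lam g).le)

/-- `(−1)^n m̂^{(n)}_k(λ) > 0` on the ray, for every `n` (the integrand is positive off the `ν`-null
rotation subgroup). -/
theorem iteratedDeriv_jacobi_weight_sign_pos (lam : ℝ) (n : ℕ) {k : ℝ} (hk : 1 < k) (h1 : lam < k)
    (h2 : 2 < k + lam) :
    0 < (-1 : ℝ) ^ n
        * iteratedDeriv n (fun k => ∫ g, (1 - ‖orbit g‖ ^ 2) ^ (k / 2) * sph lam g ∂(nu haarCircle)) k := by
  rw [iteratedDeriv_jacobi_weight_eq_moment lam n hk h1 h2]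
  have hnn : 0 ≤ fun g : SU11 => Real.log ‖mat g 0 0‖ ^ n * ((1 - ‖orbit g‖ ^ 2) ^ (k / 2) * sph lam g) :=
    fun g => mul_nonneg (pow_nonneg (log_norm_mat_nonneg g) n)
      (mul_nonneg (orbit_rpow_nonneg k g) (sph_pos lam g).le)
  rw [integral_pos_iff_support_of_nonneg hnn (integrable_log_pow_mul_orbit_rpow_mul_sph hk h1 h2 n)]
  refine lt_of_lt_of_le nu_orbit_ne_zero_pos (measure_mono fun g hg => ?_)
  simp only [mem_setOf_eq] at hg
  simp only [Function.mem_support, ne_eq]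
  exact (mul_pos (pow_pos (log_norm_mat_pos hg) n)
    (mul_pos (Real.rpow_pos_of_pos (one_sub_norm_orbit_sq_pos g) _) (sph_pos lam g))).ne'

/-! ### The moments in the phase variable, and the cross-check at `λ = 0` -/

/-- **The moments in Laplace form**: on the ray,
`∫_G (log|a|)^n m_k φ_λ dν = 2π ∫_0^∞ sⁿ e^{−(k−2)s} Φ_λ(s) ds`. -/
theorem integral_log_pow_mul_orbit_rpow_mul_sph_eq_phase (lam : ℝ) (n : ℕ) {k : ℝ} (hk : 1 < k)
    (h1 : lam < k) (h2 : 2 < k + lam) :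
    ∫ g, Real.log ‖mat g 0 0‖ ^ n * ((1 - ‖orbit g‖ ^ 2) ^ (k / 2) * sph lam g) ∂(nu haarCircle)
      = 2 * π * ∫ s in Ioi (0 : ℝ), s ^ n * Real.exp (-((k - 2) * s)) * sphPhase lam s := by
  have hF : Continuous fun s : ℝ => s ^ n * Real.exp (-(k * s)) * sphPhase lam s :=
    ((continuous_id.pow n).mul (Real.continuous_exp.comp (continuous_const.mul continuous_id).neg)).mul
      (continuous_sphPhase lam)
  have hF0 : ∀ s, 0 ≤ s → 0 ≤ s ^ n * Real.exp (-(k * s)) * sphPhase lam s := fun s hs =>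
    mul_nonneg (mul_nonneg (pow_nonneg hs n) (Real.exp_pos _).le) (sphPhase_pos lam s).le
  have e : ∀ g : SU11, Real.log ‖mat g 0 0‖ ^ n * ((1 - ‖orbit g‖ ^ 2) ^ (k / 2) * sph lam g)
      = (fun s : ℝ => s ^ n * Real.exp (-(k * s)) * sphPhase lam s) (Real.log ‖mat g 0 0‖) := fun g => by
    simp only
    rw [orbit_rpow_eq_exp, sph_eq_sphPhase, mul_assoc]
  have hint : Integrable (fun g => (fun s : ℝ => s ^ n * Real.exp (-(k * s)) * sphPhase lam s)
      (Real.log ‖mat g 0 0‖)) (nu haarCircle) :=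
    (integrable_log_pow_mul_orbit_rpow_mul_sph hk h1 h2 n).congr (Filter.Eventually.of_forall e)
  rw [integral_congr_ae (Filter.Eventually.of_forall e), integral_phase_eq hF hF0 hint]
  congr 1
  refine setIntegral_congr_fun measurableSet_Ioi fun s _ => ?_
  rw [show s ^ n * Real.exp (-(k * s)) * sphPhase lam s * Real.exp (2 * s)
      = s ^ n * (Real.exp (-(k * s)) * Real.exp (2 * s)) * sphPhase lam s by ring, ← Real.exp_add]
  congr 3
  ring

/-- **Cross-check at `λ = 0`**: `m̂^{(n)}_k(0) = (−1)^n · 2π n!/(k − 2)^{n+1}` for `k > 2` — the `n`-th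
derivative of `m̂_k(0) = 2π/(k − 2)`, through the moments of the exponential law of the phase. -/
theorem iteratedDeriv_jacobi_weight_zero (n : ℕ) {k : ℝ} (hk : 2 < k) :
    iteratedDeriv n (fun k => ∫ g, (1 - ‖orbit g‖ ^ 2) ^ (k / 2) * sph 0 g ∂(nu haarCircle)) k
      = (-1) ^ n * (2 * π * ((n.factorial : ℝ) / (k - 2) ^ (n + 1))) := by
  have h := iteratedDeriv_jacobi_weight_eq_moment 0 n (k := k) (by linarith) (by linarith)
    (by linarith)
  simp_rw [sph_zero, mul_one] at h ⊢
  rw [integral_log_pow_mul_orbit_rpow n hk] at h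
  have hsq : ((-1 : ℝ) ^ n) * (-1) ^ n = 1 := by
    rw [← mul_pow, neg_one_mul, neg_neg, one_pow]
  calc iteratedDeriv n (fun k => ∫ g, (1 - ‖orbit g‖ ^ 2) ^ (k / 2) ∂(nu haarCircle)) k
      = ((-1 : ℝ) ^ n * (-1) ^ n)
          * iteratedDeriv n (fun k => ∫ g, (1 - ‖orbit g‖ ^ 2) ^ (k / 2) ∂(nu haarCircle)) k := by
        rw [hsq, one_mul]
    _ = (-1) ^ n * (2 * π * ((n.factorial : ℝ) / (k - 2) ^ (n + 1))) := by
        rw [mul_assoc, h]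

end measure

end Summit.Ventures.HodgeRepro2.T5SU11JacobiWeightDerivAll
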